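import Summits.CriticalPhenomena.PercolationContinuityZ3.Theorems.PercNearOneGluingNoHeavyLowerTailAntitheticSealing
import HarnessLib

/-!
# `NoHeavyLowerTail` (stmt-CriticalPhenomena-4575) — antithetic cluster pairs: cluster tools and the ZONES of a cone
# (prim-hp-2 gen 35/36; MEMO-gen35 §4b, THEOREM-I-cones.md §1, MEMO-gen36 §1–§2)

Support file (`--supports stmt-CriticalPhenomena-4575`, hull-port prover `prim-hp-2`, gen 36).  No named facts, no sorries; standard
axioms.  The `def`s (`Antithetic.Cone.*`) are the proof-internal bookkeeping of THEOREM I (cones), proved in the companion file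
`…AntitheticCones`: for a colouring `T` (red edges) of an edge set `E` with apex `s` and a vertex `u`,
* `Cone.hEdges E s` — the edges of `E` not at `s` (`H = G − s`);
* `Cone.oppConf E s T u` — the `H`-edges of the colour opposite to the spoke `su`;
* `Cone.zone E s T u` — the ZONE `J_u(T)`, the cluster of `u` in `oppConf` (THEOREM-I-cones.md §1);
* `Cone.zblock E s T u` — the zone block `S(J_u) = {e ∈ E : e meets J_u}`;
* `Cone.zalg E s R T` — the Boolean algebra of edge sets splitting no zone block of an `R`-vertex;
* `Cone.ztop E s R T` — the top colouring (zone blocks recoloured so that their spokes are red, red elsewhere);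
* `Cone.zpart E s R T` — the part of `T`: `{ztop ∆ A : A ∈ zalg}`.

General cluster tools (any graph): `Antithetic.not_mem_of_boundary` (a pair from outside an open cluster into it
is closed), `openCluster_eq_of_agree` (cluster congruence: configurations agreeing on all pairs at the cluster have the same cluster),
`reachable_of_sealed_le_walk` / `openEdgeCluster_subset_of_sealed_le` (the gen-35 sealing lemma with "agree outside `J`" weakened to
"at least as open outside `J`"), `not_reachable_of_sealed`.

Zone lemmas (cone, `u` not joined to `s` in both colours): every vertex of `J_u` with a spoke has its spoke coloured like `su`
(`Cone.spoke_iff_of_mem_zone`); every edge from outside `J_u` into `J_u` has that colour (`Cone.boundary_iff`); a colouring agreeing with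
`T` or with `Tᶜ` on the whole block `S(J_u)` has the same zone (`Cone.zone_eq_of_agree`, THEOREM-I-cones.md Claim 3).
[cite: VandenbergHaggstromKahn2005, §1 p. 3 (open cluster `C_s`)]
-/

noncomputable section

namespace Summit.CriticalPhenomena.PercolationContinuityZ3.Theorems

open Literature.Probability.Percolation
open scoped Classical symmDiff

namespace Antithetic

/-! ## Cluster tools (general graphs) -/
section ClusterTools

variable {V : Type*}

/-- A pair joining a vertex outside an open cluster to a vertex inside it is closed. [folklore] -/
theorem not_mem_of_boundary (ω : BondConfig V) (u : V) {x y : V} (hx : x ∉ openCluster ω u)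
    (hy : y ∈ openCluster ω u) : s(x, y) ∉ ω := by
  intro h
  apply hx
  have hxy : y ≠ x := fun hyx => hx (hyx ▸ hy)
  have hadj : (openGraph ω).Adj y x := by
    rw [openGraph_adj, Sym2.eq_swap]
    exact ⟨h, hxy⟩
  exact (show (openGraph ω).Reachable u y from hy).trans hadj.reachable

/-- **Cluster congruence.**  If `ω'` agrees with `ω` on every pair meeting the open cluster of `u` in `ω`, then the open cluster of
`u` is the same in `ω'`. [folklore] -/
theorem openCluster_eq_of_agree (ω ω' : BondConfig V) (u : V)
    (h : ∀ x ∈ openCluster ω u, ∀ y, (s(x, y) ∈ ω ↔ s(x, y) ∈ ω')) :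
    openCluster ω' u = openCluster ω u := by
  -- walks in `ω'` from `u` stay inside the `ω`-cluster
  have key₁ : ∀ {a b : V} (_ : (openGraph ω').Walk a b), a ∈ openCluster ω u → b ∈ openCluster ω u := by
    intro a b p
    induction p with
    | nil => exact id
    | @cons a c b hac _ ih =>
      intro ha
      rw [openGraph_adj] at hac
      have hac' : (openGraph ω).Adj a c := (openGraph_adj ω a c).2 ⟨(h a ha c).2 hac.1, hac.2⟩
      exact ih ((show (openGraph ω).Reachable u a from ha).trans hac'.reachable)
  -- walks in `ω` from `u` are walks in `ω'`
  have key₂ : ∀ {a b : V} (_ : (openGraph ω).Walk a b), a ∈ openCluster ω u → a ∈ openCluster ω' u →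
      b ∈ openCluster ω' u := by
    intro a b p
    induction p with
    | nil => exact fun _ h => h
    | @cons a c b hac _ ih =>
      intro ha ha'
      rw [openGraph_adj] at hac
      have hc : c ∈ openCluster ω u :=
        (show (openGraph ω).Reachable u a from ha).trans ((openGraph_adj ω a c).2 hac).reachable
      have hac' : (openGraph ω').Adj a c := (openGraph_adj ω' a c).2 ⟨(h a ha c).1 hac.1, hac.2⟩
      exact ih hc ((show (openGraph ω').Reachable u a from ha').trans hac'.reachable)
  ext z
  constructor
  · intro hz
    obtain ⟨p⟩ := (show (openGraph ω').Reachable u z from hz)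
    exact key₁ p (mem_openCluster_self ω u)
  · intro hz
    obtain ⟨p⟩ := (show (openGraph ω).Reachable u z from hz)
    exact key₂ p (mem_openCluster_self ω u) (mem_openCluster_self ω' u)

/-- **Sealing lemma, `≤` form (walks).**  `ω` contains every `ω'`-open pair with both endpoints outside `J`, and `ω'` has no open pair
from outside `J` into `J`.  Then an `ω'`-open walk starting outside `J` stays outside `J` and is `ω`-open. [this work] -/
theorem reachable_of_sealed_le_walk (ω ω' : BondConfig V) (J : Set V)
    (hle : ∀ x y, x ∉ J → y ∉ J → s(x, y) ∈ ω' → s(x, y) ∈ ω)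
    (hseal : ∀ x y, x ∉ J → y ∈ J → s(x, y) ∉ ω') :
    ∀ {u x : V} (_ : (openGraph ω').Walk u x), u ∉ J → (openGraph ω).Reachable u x ∧ x ∉ J := by
  intro u x p
  induction p with
  | nil => exact fun hu => ⟨SimpleGraph.Reachable.refl _, hu⟩
  | @cons a b c hab _ ih =>
    intro ha
    rw [openGraph_adj] at hab
    have hb : b ∉ J := fun hbJ => hseal a b ha hbJ hab.1
    have hab' : (openGraph ω).Adj a b := by
      rw [openGraph_adj]
      exact ⟨hle a b ha hb hab.1, hab.2⟩
    obtain ⟨hbc, hc⟩ := ih hb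
    exact ⟨hab'.reachable.trans hbc, hc⟩

/-- Sealing, `≤` form, for BHK's open EDGE cluster: under the hypotheses of `reachable_of_sealed_le_walk` and `s ∉ J`,
`C_s(ω') ⊆ C_s(ω)`. [cite: VandenbergHaggstromKahn2005, §1 p. 3 (open cluster `C_s`)] -/
theorem openEdgeCluster_subset_of_sealed_le (ω ω' : BondConfig V) (s : V) (J : Set V) (hs : s ∉ J)
    (hle : ∀ x y, x ∉ J → y ∉ J → s(x, y) ∈ ω' → s(x, y) ∈ ω)
    (hseal : ∀ x y, x ∉ J → y ∈ J → s(x, y) ∉ ω') :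
    openEdgeCluster ω' s ⊆ openEdgeCluster ω s := by
  intro e he
  rw [mem_openEdgeCluster_iff] at he ⊢
  obtain ⟨heω', hdiag, hreach⟩ := he
  have hout : ∀ v ∈ e, (openGraph ω).Reachable s v ∧ v ∉ J := fun v hv => by
    obtain ⟨p⟩ := hreach v hv
    exact reachable_of_sealed_le_walk ω ω' J hle hseal p hs
  refine ⟨?_, hdiag, fun v hv => (hout v hv).1⟩
  induction e using Sym2.ind with
  | h x y => exact hle x y (hout x (Sym2.mem_mk_left x y)).2 (hout y (Sym2.mem_mk_right x y)).2 heω'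

/-- No open path enters a sealed vertex set: if `s ∉ J` and `ω` has no open pair from outside `J` into `J`, then no vertex of `J`
is `ω`-reachable from `s`. [this work] -/
theorem not_reachable_of_sealed (ω : BondConfig V) (s : V) (J : Set V) (hs : s ∉ J)
    (hseal : ∀ x y, x ∉ J → y ∈ J → s(x, y) ∉ ω) {x : V} (hx : x ∈ J) : ¬ (openGraph ω).Reachable s x :=
  fun h => (reachable_of_sealed ω ω s J hs (fun _ _ _ _ => Iff.rfl) hseal h).2 hx

end ClusterTools

/-! ## Zones of a cone -/
namespace Cone

variable {V : Type*}

/-- The `H`-edges: edges of `E` not containing the apex `s` (`H = G − s`). [this work] -/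
def hEdges (E : Set (Sym2 V)) (s : V) : Set (Sym2 V) := {e | e ∈ E ∧ s ∉ e}

/-- The `H`-edges of the colour OPPOSITE to the spoke `su` of `u` in the colouring `T` (`T` red). [this work] -/
def oppConf (E : Set (Sym2 V)) (s : V) (T : Set (Sym2 V)) (u : V) : Set (Sym2 V) :=
  (if s(s, u) ∈ T then Tᶜ else T) ∩ hEdges E s

/-- The ZONE `J_u(T)`: the cluster of `u` in the `H`-edges of the colour opposite to its spoke (THEOREM-I-cones.md §1). [this work] -/
def zone (E : Set (Sym2 V)) (s : V) (T : Set (Sym2 V)) (u : V) : Set V := openCluster (oppConf E s T u) u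

/-- The zone BLOCK `S(J_u) = {e ∈ E : e meets J_u}` (spokes of the zone and `H`-edges at it). [this work] -/
def zblock (E : Set (Sym2 V)) (s : V) (T : Set (Sym2 V)) (u : V) : Set (Sym2 V) :=
  {e | e ∈ E ∧ ∃ x ∈ zone E s T u, x ∈ e}

/-- The block ALGEBRA of `T`: edge sets that split no zone block of an `R`-vertex. [this work] -/
def zalg (E : Set (Sym2 V)) (s : V) (R : Set V) (T : Set (Sym2 V)) : Set (Set (Sym2 V)) :=
  {A | ∀ u ∈ R, zblock E s T u ⊆ A ∨ Disjoint (zblock E s T u) A}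

/-- The TOP colouring `N_T`: on each zone block, `T` recoloured so that the zone's spokes are red; red elsewhere. [this work] -/
def ztop (E : Set (Sym2 V)) (s : V) (R : Set V) (T : Set (Sym2 V)) : Set (Sym2 V) :=
  {e | ∀ u ∈ R, e ∈ zblock E s T u → (e ∈ T ↔ s(s, u) ∈ T)}

/-- The PART of `T`: the colourings `N_T ∆ A`, `A` in the block algebra (the tied zone cube through `T`). [this work] -/
def zpart [Fintype V] (E : Set (Sym2 V)) (s : V) (R : Set V) (T : Set (Sym2 V)) : Finset (Set (Sym2 V)) :=
  (Finset.univ.filter fun A => A ∈ zalg E s R T).image fun A => ztop E s R T ∆ A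

section Basic

variable (E : Set (Sym2 V)) (s : V) (T : Set (Sym2 V)) (u : V)

/-- `u` lies in its own zone. [this work] -/
theorem mem_zone_self : u ∈ zone E s T u := mem_openCluster_self _ u

/-- A pair containing the apex is not an `H`-edge of any colour. [this work] -/
theorem not_mem_oppConf_of_mem {e : Sym2 V} (he : s ∈ e) : e ∉ oppConf E s T u := fun h => h.2.2 he

/-- The opposite-colour `H`-configuration lies inside `E`. [this work] -/
theorem oppConf_subset : oppConf E s T u ⊆ (if s(s, u) ∈ T then Tᶜ else T) ∩ E := fun _ he => ⟨he.1, he.2.1⟩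

variable {E s T u}

/-- The apex lies in no zone of a vertex `u ≠ s`. [this work] -/
theorem apex_not_mem_zone (hus : u ≠ s) : s ∉ zone E s T u := fun h =>
  (reachable_of_sealed (oppConf E s T u) (oppConf E s T u) u {s} hus (fun _ _ _ _ => Iff.rfl)
    (fun x y _ (hy : y ∈ ({s} : Set V)) => by
      rw [Set.mem_singleton_iff] at hy
      rw [hy]
      exact not_mem_oppConf_of_mem E s T u (Sym2.mem_mk_right x s)) h).2 rfl

/-- A zone vertex is not the apex. [this work] -/
theorem ne_apex_of_mem_zone (hus : u ≠ s) {y : V} (hy : y ∈ zone E s T u) : y ≠ s := fun h =>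
  apex_not_mem_zone hus (h ▸ hy)

/-- **Spokes of a zone** (THEOREM-I-cones.md (★), one direction).  If `u` is not joined to `s` in both colours, every vertex `y` of
the zone `J_u` whose spoke `sy` is an edge has its spoke coloured like `su`. [this work] -/
theorem spoke_iff_of_mem_zone (hus : u ≠ s) (hsu : s(s, u) ∈ E)
    (hTu : ¬ ((openGraph (T ∩ E)).Reachable s u ∧ (openGraph (Tᶜ ∩ E)).Reachable s u)) {y : V}
    (hy : y ∈ zone E s T u) (hsy : s(s, y) ∈ E) : (s(s, y) ∈ T ↔ s(s, u) ∈ T) := by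
  have hys : y ≠ s := ne_apex_of_mem_zone hus hy
  have hreach : (openGraph (oppConf E s T u)).Reachable y u := (show (openGraph _).Reachable u y from hy).symm
  by_cases hu : s(s, u) ∈ T
  · simp only [hu, iff_true]
    by_contra hyT
    refine hTu ⟨?_, ?_⟩
    · exact ((openGraph_adj (T ∩ E) s u).2 ⟨⟨hu, hsu⟩, hus.symm⟩).reachable
    · have h1 : (openGraph (Tᶜ ∩ E)).Adj s y := (openGraph_adj _ s y).2 ⟨⟨hyT, hsy⟩, hys.symm⟩
      have h2 : (openGraph (Tᶜ ∩ E)).Reachable y u := by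
        refine hreach.mono (SimpleGraph.fromEdgeSet_mono ((oppConf_subset E s T u).trans ?_))
        rw [if_pos hu]
      exact h1.reachable.trans h2
  · simp only [hu, iff_false]
    intro hyT
    refine hTu ⟨?_, ?_⟩
    · have h1 : (openGraph (T ∩ E)).Adj s y := (openGraph_adj _ s y).2 ⟨⟨hyT, hsy⟩, hys.symm⟩
      have h2 : (openGraph (T ∩ E)).Reachable y u := by
        refine hreach.mono (SimpleGraph.fromEdgeSet_mono ((oppConf_subset E s T u).trans ?_))
        rw [if_neg hu]
      exact h1.reachable.trans h2
    · have hu' : s(s, u) ∈ Tᶜ := hu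
      exact ((openGraph_adj (Tᶜ ∩ E) s u).2 ⟨⟨hu', hsu⟩, hus.symm⟩).reachable

/-- **Boundary of a zone** (THEOREM-I-cones.md §1): every EDGE from outside `J_u` into `J_u` — a spoke or an `H`-edge — has the
colour of the spoke `su` (for `u` not joined to `s` in both colours). [this work] -/
theorem boundary_iff (hus : u ≠ s) (hsu : s(s, u) ∈ E)
    (hTu : ¬ ((openGraph (T ∩ E)).Reachable s u ∧ (openGraph (Tᶜ ∩ E)).Reachable s u)) {x y : V}
    (hx : x ∉ zone E s T u) (hy : y ∈ zone E s T u) (hxy : s(x, y) ∈ E) : (s(x, y) ∈ T ↔ s(s, u) ∈ T) := by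
  by_cases hxs : x = s
  · subst hxs
    exact spoke_iff_of_mem_zone hus hsu hTu hy hxy
  · have hys : y ≠ s := ne_apex_of_mem_zone hus hy
    have hH : s(x, y) ∈ hEdges E s := by
      refine ⟨hxy, fun h => ?_⟩
      rcases Sym2.mem_iff.1 h with h | h
      · exact hxs h.symm
      · exact hys h.symm
    have hb : s(x, y) ∉ oppConf E s T u := not_mem_of_boundary _ u hx hy
    by_cases hu : s(s, u) ∈ T
    · simp only [hu, iff_true]
      by_contra h
      exact hb ⟨by rw [if_pos hu]; exact h, hH⟩
    · simp only [hu, iff_false]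
      intro h
      exact hb ⟨by rw [if_neg hu]; exact h, hH⟩

/-- The spoke `su` belongs to the zone block of `u`. [this work] -/
theorem spoke_mem_zblock (hsu : s(s, u) ∈ E) : s(s, u) ∈ zblock E s T u :=
  ⟨hsu, u, mem_zone_self E s T u, Sym2.mem_mk_right s u⟩

/-- **Zone invariance** (THEOREM-I-cones.md Claim 3): a colouring `M` that agrees with `T` on the whole zone block of `u`, or with
`Tᶜ` on the whole zone block, has the same zone `J_u`. [this work] -/
theorem zone_eq_of_agree (hsu : s(s, u) ∈ E) {M : Set (Sym2 V)}
    (hMT : (∀ e ∈ zblock E s T u, (e ∈ M ↔ e ∈ T)) ∨ (∀ e ∈ zblock E s T u, (e ∈ M ↔ e ∉ T))) :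
    zone E s M u = zone E s T u := by
  apply openCluster_eq_of_agree
  intro x hx y
  by_cases hH : s(x, y) ∈ hEdges E s
  · have hxyb : s(x, y) ∈ zblock E s T u := ⟨hH.1, x, hx, Sym2.mem_mk_left x y⟩
    have hsub : s(s, u) ∈ zblock E s T u := spoke_mem_zblock hsu
    simp only [oppConf, Set.mem_inter_iff, hH, and_true]
    rcases hMT with h | h
    · have h1 := h _ hxyb
      have h2 := h _ hsub
      by_cases hu : s(s, u) ∈ T
      · rw [if_pos hu, if_pos (h2.2 hu), Set.mem_compl_iff, Set.mem_compl_iff, h1]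
      · rw [if_neg hu, if_neg (fun h' => hu (h2.1 h')), h1]
    · have h1 := h _ hxyb
      have h2 := h _ hsub
      by_cases hu : s(s, u) ∈ T
      · rw [if_pos hu, if_neg (fun h' => h2.1 h' hu), Set.mem_compl_iff, h1]
      · rw [if_neg hu, if_pos (h2.2 hu), Set.mem_compl_iff, h1, not_not]
  · constructor
    · exact fun h => absurd h.2 hH
    · exact fun h => absurd h.2 hH

end Basic

end Cone

end Antithetic

end Summit.CriticalPhenomena.PercolationContinuityZ3.Theorems
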